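import Literature.Analysis.FluidPDE.TorusNSBerselliGaldiCriterionLowest
import Literature.Analysis.FunctionSpaces.TorusWeightedSobolevInequality
import HarnessLib

/-!
# Small data in `L³`: global continuation of classical Navier–Stokes solutions on `T³`
# by the `L³` energy method (Robinson–Sadowski 2014, Theorem 6 (ii); Kato 1984)

Analysis/FluidPDE proof file (theorems only; no definitions, no named facts).
Search for candidate a priori estimates; no regularity claim.

Robinson–Sadowski 2014 (Rend. Sem. Mat. Univ. Padova 131), Theorem 6 (ii) (`V = ℝ³` or `T³`,
`ν = 1`): "if `u₀ ∈ L³ ∩ L²` and `‖u₀‖_{L³}` is sufficiently small then the equations have a unique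
global solution `u ∈ L^∞(0, ∞; L³)`" — the energy-method version (there via the local criterion
(2) and the heat flow of the datum) of Kato's 1984 small-data theorem in the critical space `L³`.
Here, for CLASSICAL solutions on the unit torus with mean-zero velocity slices, in continuation
form and with the viscosity restored (the scale-invariant smallness `‖u(0)‖_{L³} ≲ ν`):

* `Torus.classicalNS_continuation_of_small_L3` — there is `ε = ε(d) > 0` such that every classical
  solution of the unforced Navier–Stokes equations (`ν > 0`) on `[0, T) × T^d`, `card d = 3`,
  `T > 0`, with mean-zero velocity slices and `∫‖u(0)‖³ ≤ ε ν³`, satisfies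
  `∫‖u(t)‖³ ≤ ∫‖u(0)‖³` on `[0, T)` and continues to a classical solution with mean-zero slices on
  some `[0, T'] × T^d`, `T' > T`, equal to `u` on `[0, T)` (so it never leaves the small ball and
  can be continued indefinitely).

PROOF (the `q = 3` endpoint of the chain of Robinson–Sadowski's Theorem 8 / Bleitner–Protas 2026
App. A, where Young's inequality is unavailable — "we can only use Young's inequality here when
`α > 3`" — but smallness closes the estimate): along the solution, for every one-sided derivative
`R` of `U(t) = ∫‖u(t)‖³`,
`R ≤ −3ν X + κ ν⁻¹ U^{2/3} X`, `X = ∫ |u| |∇u|²`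
(the `L³` balance RRS 2016 (11.19) applied to `(u, p − ⟨p⟩)`, Calderón–Zygmund
`‖p − ⟨p⟩‖_{5/2} ≤ C‖u‖₅²`, Hölder, interpolation `‖u‖₅⁵ ≤ ‖u‖₃²‖u‖₉³`, and the weighted Sobolev
inequality `‖u‖₉³ ≤ c X` of Robinson–Sadowski's Lemma 2, tree
`Torus.exists_rpow_integral_norm_rpow_le_weighted`); hence `R ≤ −(3ν/2) X ≤ 0` as long as
`κ U^{2/3} ≤ (3/2) ν²`, which propagates from `t = 0` by a trapping argument (first time at which
`U` reaches the threshold); then `U + (3ν/2)∫₀ᵗ X` is non-increasing, so `∫₀ᵗ ‖u‖_{L⁹}³ ≤ c∫₀ᵗ X ≤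
2c U(0)/(3ν)`: `u ∈ L³(0,T; L⁹)`, a Serrin class (`2/3 + 3/9 = 1`), and the tree's Serrin
continuation `Torus.classicalNS_continuation_of_Ls_rpow_integral_le` (`s = 9`) applies.
Deviations from print: classical solutions with mean-zero slices on the unit torus (print:
`u₀ ∈ L³ ∩ L²`, solutions in `L^∞(0,∞;L³)` constructed by approximation); smallness as
`∫‖u(0)‖³ ≤ εν³` with `ε = ε(d)` existential; uniqueness not restated.

## Mathlib / tree search

Tree (used): `Torus.IsClassicalNSSolutionOn.deriv_integral_normSq_rpow_le_of_two_le`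
(`TorusVelocityRealMomentBalance`), `Torus.exists_pressure_sub_average_Ls_le_normSq`
(`TorusNSBerselliGaldiCriterionLowest`), `Torus.exists_rpow_integral_norm_rpow_le_weighted`
(`TorusWeightedSobolevInequality`), `Torus.classicalNS_continuation_of_Ls_rpow_integral_le`
(`TorusNSSerrinCriterion`), `Torus.hasDerivWithinAt_integral_of_convex`,
`Torus.continuousOn_integral_of_continuousOn_stLift`; Mathlib
`intervalIntegral.integral_hasDerivWithinAt_right`, `antitoneOn_of_hasDerivWithinAt_nonpos`,
`IsClosed.csInf_mem`. Searched (`lean search`): `small.*L3|L³.*small|Kato1984|smallData.*torus` —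
`ℝ³` named facts `koch_tataru`, `fujita_kato_*` (CriticalRegularity) only; no torus classical
small-data continuation.

## References

* J. C. Robinson, W. Sadowski, *A local smoothness criterion for solutions of the 3D Navier–Stokes
  equations*, Rend. Semin. Mat. Univ. Padova 131 (2014) 159–178, Theorem 6 (ii) (p. 172) and the
  proof of Theorem 8 (pp. 175–176) (held: paper:doi-10-4171-rsmup-131-9). [RobinsonSadowski2014]
* T. Kato, *Strong `L^p`-solutions of the Navier–Stokes equation in `ℝ^m`, with applications to
  weak solutions*, Math. Z. 187 (1984) 471–480. [cited through Robinson–Sadowski]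
* J. C. Robinson, J. L. Rodrigo, W. Sadowski, *The Three-Dimensional Navier–Stokes Equations*,
  CUP 2016, Exercise 11.4 (11.19), Thm 8.17. [RobinsonRodrigoSadowskiCUP2016]
-/

noncomputable section

open MeasureTheory Finset Set Filter Topology
open scoped InnerProductSpace RealInnerProductSpace ContDiff

namespace Literature.Analysis.FluidPDE

open Literature.Analysis.FunctionSpaces

variable {d : Type*} [Fintype d] [DecidableEq d]

namespace SmallL3

/-! ## 1. Helpers (as in `TorusNSLebesgueNormGrowthRate`) -/

/-- Shifting the pressure by a constant gives again a classical solution (same velocity, same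
force): `∇(p − c) = ∇p`. [folklore] -/
private theorem pressure_sub_const {S : Set ℝ} {ν : ℝ}
    {f u : ℝ → UnitAddTorus d → EuclideanSpace ℝ d} {p : ℝ → UnitAddTorus d → ℝ}
    (h : Torus.IsClassicalNSSolutionOn S ν f u p) (c : ℝ) :
    Torus.IsClassicalNSSolutionOn S ν f u (fun t x => p t x - c) where
  smooth_velocity := h.smooth_velocity
  smooth_pressure :=
    h.smooth_pressure.sub (Torus.isSmoothSpaceTimeOn_const (Torus.isSmooth_const c) S)
  momentum t ht x := by
    rw [Torus.gradient_sub_const_apply]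
    exact h.momentum t ht x
  divFree := h.divFree

omit [DecidableEq d] in
/-- Hölder on `T^d` with weights `a + b = 1` for continuous non-negative `f, g`:
`∫ f g ≤ (∫ f^{1/a})^a (∫ g^{1/b})^b`. [folklore] -/
private theorem integral_mul_le_rpow_mul_rpow {f g : UnitAddTorus d → ℝ} (hf : Continuous f)
    (hg : Continuous g) (hf0 : ∀ x, 0 ≤ f x) (hg0 : ∀ x, 0 ≤ g x) {a b : ℝ} (ha : 0 < a)
    (hb : 0 < b) (hab : a + b = 1) :
    ∫ x, f x * g x ≤ (∫ x, f x ^ a⁻¹) ^ a * (∫ x, g x ^ b⁻¹) ^ b := by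
  have hpq : (a⁻¹).HolderConjugate b⁻¹ := Real.HolderConjugate.inv_inv ha hb hab
  have h := integral_mul_le_Lp_mul_Lq_of_nonneg (μ := volume) hpq (ae_of_all _ hf0)
    (ae_of_all _ hg0) (hf.memLp_of_hasCompactSupport (HasCompactSupport.of_compactSpace f))
    (hg.memLp_of_hasCompactSupport (HasCompactSupport.of_compactSpace g))
  simpa only [one_div, inv_inv] using h


/-! ## 2. The `L^q` rate law before Young's inequality (`q ≥ 3`) -/

/-- **The `L^q` balance estimated up to Young's inequality, `q ≥ 3`.** There is `κ = κ(q, d) ≥ 0`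
such that along every classical mean-zero solution on `[a, b] × T^d` (`card d = 3`), every
one-sided derivative `R` of `s ↦ ∫‖u(s)‖^q` within `[a, b]` at `t` satisfies
`R ≤ −qν X + κ ν⁻¹ U^{(q−1)/q} X^{3/q}`, `X = ∫‖u‖^{q−2}∑ₖ‖∂ₖu‖²`, `U = ∫‖u‖^q` (RRS (11.19),
Calderón–Zygmund, Hölder, interpolation, Robinson–Sadowski Lemma 2 — the chain of Bleitner–Protas
2026 App. A before its last step; at `q = 3`: `R ≤ −3νX + κν⁻¹U^{2/3}X`).
[cite: RobinsonSadowski2014, Theorem 8 (proof, pp. 175–176)] -/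
private theorem exists_deriv_le_preYoung (hd : Fintype.card d = 3) {q : ℝ} (hq : 3 ≤ q) :
    ∃ κ : ℝ, 0 ≤ κ ∧ ∀ {ν a b : ℝ}, 0 < ν → a < b →
      ∀ {u : ℝ → UnitAddTorus d → EuclideanSpace ℝ d} {p : ℝ → UnitAddTorus d → ℝ},
        Torus.IsClassicalNSSolutionOn (Icc a b) ν 0 u p →
        (∀ t ∈ Icc a b, Torus.HasZeroMean (u t)) →
        ∀ t ∈ Icc a b, ∀ R : ℝ,
          HasDerivWithinAt (fun s => ∫ x, ‖u s x‖ ^ q) R (Icc a b) t →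
          R ≤ -(q * ν * ∫ x, ‖u t x‖ ^ (q - 2) * ∑ k, ‖Torus.partialDeriv k (u t) x‖ ^ 2) +
            κ * ν⁻¹ * ((∫ x, ‖u t x‖ ^ q) ^ ((q - 1) / q) *
              (∫ x, ‖u t x‖ ^ (q - 2) * ∑ k, ‖Torus.partialDeriv k (u t) x‖ ^ 2) ^ (3 / q)) := by
  haveI : Nonempty d := by rw [← Fintype.card_pos_iff, hd]; norm_num
  have hq0 : 0 < q := by linarith
  have hq2 : 2 < q := by linarith
  have hqne : q ≠ 0 := hq0.ne'
  have hq1ne : q - 1 ≠ 0 := (by linarith : (0 : ℝ) < q - 1).ne'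
  have hq2ne : q - 2 ≠ 0 := (by linarith : (0 : ℝ) < q - 2).ne'
  have hq2ne' : q + 2 ≠ 0 := (by linarith : (0 : ℝ) < q + 2).ne'
  -- the two analytic constants
  obtain ⟨CP, hCP0, hCP⟩ :=
    Torus.exists_pressure_sub_average_Ls_le_normSq (d := d) (γ := (q + 2) / 2) (by linarith)
  obtain ⟨c, hc0, hc⟩ := Torus.exists_rpow_integral_norm_rpow_le_weighted (d := d) hd hq2
  -- exponents
  set θ : ℝ := 3 / q with hθ
  have hθ0 : 0 < θ := by rw [hθ]; positivity
  set coef : ℝ := q * (q - 2) / 4 * CP ^ 2 * c ^ θ with hcoef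
  have hcoef0 : 0 ≤ coef := by
    have : 0 ≤ q * (q - 2) / 4 := by nlinarith
    rw [hcoef]
    exact mul_nonneg (mul_nonneg this (sq_nonneg _)) (Real.rpow_nonneg hc0 _)
  refine ⟨coef, hcoef0, fun {ν a b} hν hab {u p} h hmean t ht R hR => ?_⟩
  -- ### Step 0: the balance (A.1) for the solution `(u, p − ⟨p(t)⟩)`
  have e_fun : (fun s => ∫ x, ‖u s x‖ ^ q) = fun s => ∫ x, (‖u s x‖ ^ 2) ^ (q / 2) := by
    funext s
    refine integral_congr_ae (ae_of_all _ fun x => ?_)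
    show ‖u s x‖ ^ q = (‖u s x‖ ^ 2) ^ (q / 2)
    rw [← Real.rpow_natCast, ← Real.rpow_mul (norm_nonneg _)]
    congr 1; push_cast; ring
  rw [e_fun] at hR
  set c₀ : ℝ := ∫ y, p t y with hc₀
  have h' := pressure_sub_const h c₀
  have hbal := h'.deriv_integral_normSq_rpow_le_of_two_le hν hab (α := q) (by linarith) ht hR
  simp only [Pi.zero_apply, inner_zero_right, mul_zero, integral_zero, add_zero] at hbal
  -- ### notation for the slice
  have hut : Torus.IsSmooth (u t) := h.smooth_velocity.isSmooth_slice ht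
  have hpt : Torus.IsSmooth (p t) := h.smooth_pressure.isSmooth_slice ht
  have huc : Continuous (u t) := hut.continuous
  have hwc : Continuous fun x => ‖u t x‖ := huc.norm
  have hπc : Continuous fun x => p t x - c₀ := hpt.continuous.sub continuous_const
  have hgradc : Continuous fun x => ∑ k, ‖Torus.partialDeriv k (u t) x‖ ^ 2 :=
    continuous_finsetSum _ fun k _ => (hut.partialDeriv k).continuous.norm.pow 2
  have hgrad0 : ∀ x, 0 ≤ ∑ k, ‖Torus.partialDeriv k (u t) x‖ ^ 2 := fun x =>
    Finset.sum_nonneg fun k _ => sq_nonneg _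
  set X : ℝ := ∫ x, ‖u t x‖ ^ (q - 2) * ∑ k, ‖Torus.partialDeriv k (u t) x‖ ^ 2 with hX
  set U : ℝ := ∫ x, ‖u t x‖ ^ q with hU
  set A : ℝ := ∫ x, ‖u t x‖ ^ (q + 2) with hA
  set B : ℝ := ∫ x, ‖u t x‖ ^ (3 * q) with hB
  set P : ℝ := ∫ x, (p t x - c₀) ^ 2 * (‖u t x‖ ^ 2) ^ (q / 2 - 1) with hP
  have hX0 : 0 ≤ X :=
    integral_nonneg fun x => mul_nonneg (Real.rpow_nonneg (norm_nonneg _) _) (hgrad0 x)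
  have hU0 : 0 ≤ U := integral_nonneg fun x => Real.rpow_nonneg (norm_nonneg _) _
  have hA0 : 0 ≤ A := integral_nonneg fun x => Real.rpow_nonneg (norm_nonneg _) _
  have hB0 : 0 ≤ B := integral_nonneg fun x => Real.rpow_nonneg (norm_nonneg _) _
  -- pointwise power identities
  have hpw : ∀ (x : UnitAddTorus d) (r : ℝ), (‖u t x‖ ^ 2) ^ r = ‖u t x‖ ^ (2 * r) :=
    fun x r => by rw [← Real.rpow_natCast, ← Real.rpow_mul (norm_nonneg _)]; push_cast; ring_nf
  have eXw : ∫ x, (‖u t x‖ ^ 2) ^ (q / 2 - 1) * ∑ k, ‖Torus.partialDeriv k (u t) x‖ ^ 2 = X := by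
    rw [hX]
    refine integral_congr_ae (ae_of_all _ fun x => ?_)
    show (‖u t x‖ ^ 2) ^ (q / 2 - 1) * _ = ‖u t x‖ ^ (q - 2) * _
    rw [hpw x, show 2 * (q / 2 - 1) = q - 2 by ring]
  rw [eXw] at hbal
  -- `hbal : R ≤ -(q * ν * X) + q / 2 * (q / 2 - 1) / ν * P`
  -- ### Step 1 (Hölder + Calderón–Zygmund): `P ≤ CP² A`
  have hP_le : P ≤ CP ^ 2 * A := by
    have ha' : 0 < 4 / (q + 2) := by positivity
    have hb' : 0 < (q - 2) / (q + 2) := by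
      have : 0 < q - 2 := by linarith
      positivity
    have hab' : 4 / (q + 2) + (q - 2) / (q + 2) = 1 := by field_simp; ring
    -- Hölder with `f = π²`, `g = (‖u‖²)^{q/2−1}`
    have hH := integral_mul_le_rpow_mul_rpow (f := fun x => (p t x - c₀) ^ 2)
      (g := fun x => (‖u t x‖ ^ 2) ^ (q / 2 - 1)) (hπc.pow 2)
      ((hwc.pow 2).rpow_const fun x => Or.inr (by linarith)) (fun x => sq_nonneg _)
      (fun x => Real.rpow_nonneg (sq_nonneg _) _) ha' hb' hab'
    -- identify the two factors
    have e1 : ∀ x, ((p t x - c₀) ^ 2) ^ (4 / (q + 2))⁻¹ = |p t x - c₀| ^ ((q + 2) / 2) := by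
      intro x
      rw [← sq_abs, ← Real.rpow_natCast, ← Real.rpow_mul (abs_nonneg _), inv_div]
      congr 1; push_cast; ring
    have e2 : ∀ x, ((‖u t x‖ ^ 2) ^ (q / 2 - 1)) ^ ((q - 2) / (q + 2))⁻¹ = ‖u t x‖ ^ (q + 2) := by
      intro x
      rw [hpw x, ← Real.rpow_mul (norm_nonneg _), inv_div]
      congr 1
      rw [show (2 : ℝ) * (q / 2 - 1) = q - 2 by ring, mul_div_assoc', mul_comm (q - 2),
        mul_div_assoc, div_self hq2ne, mul_one]
    simp only [e1, e2] at hH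
    -- the pressure bound, squared
    have hπ := hCP hab h t ht
    have hγ0 : 0 < (q + 2) / 2 := by positivity
    have e3 : ∀ x, (‖u t x‖ ^ 2) ^ ((q + 2) / 2) = ‖u t x‖ ^ (q + 2) := by
      intro x; rw [hpw x]; congr 1; ring
    simp only [e3] at hπ
    -- `hπ : (∫ |π|^{γ})^{1/γ} ≤ CP * A^{1/γ}`
    have hI0 : 0 ≤ ∫ x, |p t x - c₀| ^ ((q + 2) / 2) :=
      integral_nonneg fun x => Real.rpow_nonneg (abs_nonneg _) _
    have h4 : (∫ x, |p t x - c₀| ^ ((q + 2) / 2)) ^ (4 / (q + 2)) ≤ CP ^ 2 * A ^ (4 / (q + 2)) := by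
      have e4 : (4 : ℝ) / (q + 2) = 1 / ((q + 2) / 2) * 2 := by field_simp; ring
      have hsq : ((∫ x, |p t x - c₀| ^ ((q + 2) / 2)) ^ (1 / ((q + 2) / 2))) ^ (2 : ℝ) ≤
          (CP * A ^ (1 / ((q + 2) / 2))) ^ (2 : ℝ) :=
        Real.rpow_le_rpow (Real.rpow_nonneg hI0 _) hπ (by norm_num)
      rw [e4, Real.rpow_mul hI0, Real.rpow_mul hA0]
      calc ((∫ x, |p t x - c₀| ^ ((q + 2) / 2)) ^ (1 / ((q + 2) / 2))) ^ (2 : ℝ)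
          ≤ (CP * A ^ (1 / ((q + 2) / 2))) ^ (2 : ℝ) := hsq
        _ = CP ^ 2 * (A ^ (1 / ((q + 2) / 2))) ^ (2 : ℝ) := by
            rw [Real.mul_rpow hCP0 (Real.rpow_nonneg hA0 _)]
            norm_num
    calc P = ∫ x, (p t x - c₀) ^ 2 * (‖u t x‖ ^ 2) ^ (q / 2 - 1) := rfl
      _ ≤ (∫ x, |p t x - c₀| ^ ((q + 2) / 2)) ^ (4 / (q + 2)) *
            (∫ x, ‖u t x‖ ^ (q + 2)) ^ ((q - 2) / (q + 2)) := hH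
      _ ≤ CP ^ 2 * A ^ (4 / (q + 2)) * A ^ ((q - 2) / (q + 2)) :=
          mul_le_mul_of_nonneg_right h4 (Real.rpow_nonneg hA0 _)
      _ = CP ^ 2 * A := by
          rw [mul_assoc, ← Real.rpow_add' hA0 (by rw [hab']; norm_num), hab', Real.rpow_one]
  -- ### Step 2 (interpolation): `A ≤ U^{(q−1)/q} B^{1/q}`
  have hA_le : A ≤ U ^ ((q - 1) / q) * B ^ (1 / q) := by
    have ha' : 0 < (q - 1) / q := by
      have : 0 < q - 1 := by linarith
      positivity
    have hb' : 0 < 1 / q := by positivity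
    have hab' : (q - 1) / q + 1 / q = 1 := by field_simp; ring
    have hH := integral_mul_le_rpow_mul_rpow (f := fun x => ‖u t x‖ ^ (q - 1))
      (g := fun x => ‖u t x‖ ^ (3 : ℝ)) (hwc.rpow_const fun x => Or.inr (by linarith))
      (hwc.rpow_const fun x => Or.inr (by norm_num)) (fun x => Real.rpow_nonneg (norm_nonneg _) _)
      (fun x => Real.rpow_nonneg (norm_nonneg _) _) ha' hb' hab'
    have e0 : ∀ x, ‖u t x‖ ^ (q - 1) * ‖u t x‖ ^ (3 : ℝ) = ‖u t x‖ ^ (q + 2) := by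
      intro x
      rcases (norm_nonneg (u t x)).eq_or_lt with hz | hpos
      · rw [← hz, Real.zero_rpow hq1ne, Real.zero_rpow (by norm_num), zero_mul,
          Real.zero_rpow hq2ne']
      · rw [← Real.rpow_add hpos]; congr 1; ring
    have e1 : ∀ x, (‖u t x‖ ^ (q - 1)) ^ ((q - 1) / q)⁻¹ = ‖u t x‖ ^ q := by
      intro x
      rw [← Real.rpow_mul (norm_nonneg _), inv_div]
      congr 1
      rw [mul_div_assoc', mul_comm (q - 1), mul_div_assoc, div_self hq1ne, mul_one]
    have e2 : ∀ x, (‖u t x‖ ^ (3 : ℝ)) ^ (1 / q)⁻¹ = ‖u t x‖ ^ (3 * q) := by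
      intro x
      rw [← Real.rpow_mul (norm_nonneg _), one_div, inv_inv]
    simp only [e0, e1, e2] at hH
    exact hH
  -- ### Step 3 (weighted Sobolev): `B^{1/q} ≤ (c X)^θ`
  have hB_le : B ^ (1 / q) ≤ (c * X) ^ θ := by
    have hL := hc (u t) hut (hmean t ht)
    -- `hL : B^{1/3} ≤ c * X`
    have e : B ^ (1 / q) = (B ^ (1 / 3 : ℝ)) ^ θ := by
      rw [← Real.rpow_mul hB0, hθ]
      congr 1; field_simp
    rw [e]
    exact Real.rpow_le_rpow (Real.rpow_nonneg hB0 _) hL hθ0.le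
  -- ### Step 4: the pressure term is `≤ (coef/ν) U^{(q−1)/q} X^θ`
  have hcX0 : 0 ≤ c * X := mul_nonneg hc0 hX0
  have hT_le : q / 2 * (q / 2 - 1) / ν * P ≤ coef / ν * (U ^ ((q - 1) / q) * X ^ θ) := by
    have hq' : 0 ≤ q / 2 * (q / 2 - 1) / ν := by
      have : 0 ≤ q / 2 * (q / 2 - 1) := by nlinarith
      positivity
    have hUe : 0 ≤ U ^ ((q - 1) / q) := Real.rpow_nonneg hU0 _
    calc q / 2 * (q / 2 - 1) / ν * P ≤ q / 2 * (q / 2 - 1) / ν * (CP ^ 2 * A) :=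
          mul_le_mul_of_nonneg_left hP_le hq'
      _ ≤ q / 2 * (q / 2 - 1) / ν * (CP ^ 2 * (U ^ ((q - 1) / q) * (c * X) ^ θ)) := by
          refine mul_le_mul_of_nonneg_left (mul_le_mul_of_nonneg_left ?_ (sq_nonneg _)) hq'
          exact hA_le.trans (mul_le_mul_of_nonneg_left hB_le hUe)
      _ = coef / ν * (U ^ ((q - 1) / q) * X ^ θ) := by
          rw [Real.mul_rpow hc0 hX0, hcoef]
          ring
  calc R ≤ -(q * ν * X) + q / 2 * (q / 2 - 1) / ν * P := hbal
    _ ≤ -(q * ν * X) + coef / ν * (U ^ ((q - 1) / q) * X ^ θ) := by linarith [hT_le]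
    _ = -(q * ν * X) + coef * ν⁻¹ * (U ^ ((q - 1) / q) * X ^ θ) := by rw [div_eq_mul_inv]

/-! ## 3. Differentiability and continuity of the moments in time -/

omit [DecidableEq d] in
/-- `s ↦ ∫‖u(s)‖^q` is differentiable within `[a, b]` along a jointly smooth velocity (`q ≥ 2`):
dominated differentiation of `(‖u‖²)^{q/2}` (the weight `y ↦ y^{q/2}` is `C¹` for `q ≥ 2`).
[folklore] -/
private theorem hasDerivWithinAt_integral_norm_rpow {a b : ℝ}
    {u : ℝ → UnitAddTorus d → EuclideanSpace ℝ d} (hu : Torus.IsSmoothSpaceTimeOn (Icc a b) u)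
    (hab : a < b) {q : ℝ} (hq : 2 ≤ q) {t : ℝ} (ht : t ∈ Icc a b) :
    ∃ R : ℝ, HasDerivWithinAt (fun s => ∫ x, ‖u s x‖ ^ q) R (Icc a b) t := by
  set S : Set ℝ := Icc a b with hS
  have hU : UniqueDiffOn ℝ S := uniqueDiffOn_Icc hab
  -- `Q = ‖u‖²` and its time derivative are jointly smooth
  set Q : ℝ → UnitAddTorus d → ℝ := fun s x => ‖u s x‖ ^ 2 with hQ
  have hQst : Torus.IsSmoothSpaceTimeOn S Q := by
    have h1 := hu.inner hu
    have e : Q = fun s x => ⟪u s x, u s x⟫ := by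
      funext s x; rw [hQ, real_inner_self_eq_norm_sq]
    rw [e]; exact h1
  set Q' : ℝ → UnitAddTorus d → ℝ := Torus.timeDerivWithin S Q with hQ'
  have hQ'st : Torus.IsSmoothSpaceTimeOn S Q' := hQst.timeDerivWithin hU
  obtain ⟨B₁, hB₁⟩ := hQst.exists_norm_le_of_isCompact isCompact_Icc subset_rfl
  obtain ⟨B₂, hB₂⟩ := hQ'st.exists_norm_le_of_isCompact isCompact_Icc subset_rfl
  have hB₁0 : 0 ≤ B₁ := (norm_nonneg _).trans (hB₁ t ht (0 : UnitAddTorus d))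
  have hB₂0 : 0 ≤ B₂ := (norm_nonneg _).trans (hB₂ t ht (0 : UnitAddTorus d))
  have hr0 : 0 ≤ q / 2 - 1 := by linarith
  have h1q : (1 : ℝ) ≤ q / 2 := by linarith
  set F : ℝ → UnitAddTorus d → ℝ := fun s x => (Q s x) ^ (q / 2) with hF
  set F' : ℝ → UnitAddTorus d → ℝ := fun s x => q / 2 * (Q s x) ^ (q / 2 - 1) * Q' s x with hF'
  have hQ0 : ∀ s x, 0 ≤ Q s x := fun s x => by rw [hQ]; positivity
  have hderiv : ∀ s ∈ S, ∀ x, HasDerivWithinAt (F · x) (F' s x) S s := by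
    intro s hs x
    have h1 : HasDerivWithinAt (fun τ => Q τ x) (Q' s x) S s := hQst.hasDerivWithinAt_slice hs x
    have h2 := (Real.hasDerivAt_rpow_const (p := q / 2) (x := Q s x) (Or.inr h1q)).comp_hasDerivWithinAt s h1
    have e : F' s x = q / 2 * Q s x ^ (q / 2 - 1) * Q' s x := rfl
    rw [e]
    exact h2
  have hF_int : ∀ s ∈ S, Integrable (F s) volume := fun s hs =>
    (((hQst.isSmooth_slice hs).continuous).rpow_const fun x => Or.inr (by linarith)).integrable_unitAddTorus
  have hbound : ∀ᶠ s in 𝓝[S] t, ∀ x, ‖F' s x‖ ≤ q / 2 * B₁ ^ (q / 2 - 1) * B₂ := by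
    refine eventually_nhdsWithin_of_forall fun s hs x => ?_
    have hQle : Q s x ≤ B₁ := by
      have := hB₁ s hs x
      rw [Real.norm_of_nonneg (hQ0 s x)] at this
      exact this
    have h1 : Q s x ^ (q / 2 - 1) ≤ B₁ ^ (q / 2 - 1) := Real.rpow_le_rpow (hQ0 s x) hQle hr0
    have h2 : |Q' s x| ≤ B₂ := by
      have := hB₂ s hs x
      rwa [Real.norm_eq_abs] at this
    rw [hF', Real.norm_eq_abs]
    simp only
    rw [abs_mul, abs_mul, abs_of_nonneg (by linarith : (0 : ℝ) ≤ q / 2),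
      abs_of_nonneg (Real.rpow_nonneg (hQ0 s x) _)]
    have hq2 : (0 : ℝ) ≤ q / 2 := by linarith
    calc q / 2 * Q s x ^ (q / 2 - 1) * |Q' s x| ≤ q / 2 * B₁ ^ (q / 2 - 1) * B₂ := by
          gcongr
    _ = q / 2 * B₁ ^ (q / 2 - 1) * B₂ := rfl
  have hF'_meas : AEStronglyMeasurable (F' t) volume := by
    have hc : Continuous (F' t) :=
      ((continuous_const.mul (((hQst.isSmooth_slice ht).continuous).rpow_const
        fun x => Or.inr hr0)).mul (hQ'st.isSmooth_slice ht).continuous)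
    exact hc.aestronglyMeasurable
  have hmain := Torus.hasDerivWithinAt_integral_of_convex (μ := volume) (convex_Icc a b) ht
    hF_int hderiv hbound hF'_meas
  refine ⟨∫ x, F' t x, ?_⟩
  have e : (fun s => ∫ x, ‖u s x‖ ^ q) = fun s => ∫ x, F s x := by
    funext s
    refine integral_congr_ae (ae_of_all _ fun x => ?_)
    show ‖u s x‖ ^ q = (‖u s x‖ ^ 2) ^ (q / 2)
    rw [← Real.rpow_natCast, ← Real.rpow_mul (norm_nonneg _)]
    congr 1; push_cast; ring
  rw [e]
  exact hmain


/-- Along a classical solution on `[a, b]`, the weighted dissipation `t ↦ ∫‖u(t)‖ ∑ₖ‖∂ₖu(t)‖²`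
is continuous on `[a, b]` (joint continuity of the integrand, tube lemma). [folklore] -/
private theorem continuousOn_weightedDissipation {ν a b : ℝ} (hab : a < b)
    {f u : ℝ → UnitAddTorus d → EuclideanSpace ℝ d} {p : ℝ → UnitAddTorus d → ℝ}
    (h : Torus.IsClassicalNSSolutionOn (Icc a b) ν f u p) :
    ContinuousOn (fun t => ∫ x, ‖u t x‖ ^ ((3 : ℝ) - 2) *
      ∑ k, ‖Torus.partialDeriv k (u t) x‖ ^ 2) (Icc a b) := by
  have hU : UniqueDiffOn ℝ (Icc a b) := uniqueDiffOn_Icc hab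
  have hst : ContinuousOn (Torus.stLift u) (Icc a b ×ˢ univ) := h.smooth_velocity.continuousOn_stLift
  have hDst : ∀ k, ContinuousOn (Torus.stLift fun t x => Torus.partialDeriv k (u t) x)
      (Icc a b ×ˢ univ) := fun k => (h.smooth_velocity.partialDeriv hU k).continuousOn_stLift
  refine Torus.continuousOn_integral_of_continuousOn_stLift ?_
  have e : Torus.stLift (fun t x => ‖u t x‖ ^ ((3 : ℝ) - 2) *
      ∑ k, ‖Torus.partialDeriv k (u t) x‖ ^ 2) =
      fun z => ‖Torus.stLift u z‖ ^ ((3 : ℝ) - 2) *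
        ∑ k, ‖Torus.stLift (fun t x => Torus.partialDeriv k (u t) x) z‖ ^ 2 := rfl
  rw [e]
  exact (hst.norm.rpow_const fun z _ => Or.inr (by norm_num)).mul
    (continuousOn_finsetSum _ fun k _ => (hDst k).norm.pow 2)

/-- Along a classical solution, `t ↦ ∫ ‖u(t)‖^r` (`r ≥ 0`) is continuous on the time set.
[folklore] -/
private theorem continuousOn_integral_norm_rpow {ν : ℝ} {S : Set ℝ}
    {f u : ℝ → UnitAddTorus d → EuclideanSpace ℝ d} {p : ℝ → UnitAddTorus d → ℝ}
    (h : Torus.IsClassicalNSSolutionOn S ν f u p) {r : ℝ} (hr : 0 ≤ r) :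
    ContinuousOn (fun t => ∫ x, ‖u t x‖ ^ r) S := by
  have hst : ContinuousOn (Torus.stLift u) (S ×ˢ univ) := h.smooth_velocity.continuousOn_stLift
  refine Torus.continuousOn_integral_of_continuousOn_stLift ?_
  have e : Torus.stLift (fun t x => ‖u t x‖ ^ r) = fun z => ‖Torus.stLift u z‖ ^ r := rfl
  rw [e]
  exact hst.norm.rpow_const fun z _ => Or.inr hr

/-! ## 4. Real-analysis lemmas: trapping below a threshold, and a monotone primitive -/

omit [Fintype d] [DecidableEq d] in
/-- **Trapping.** If `U` has one-sided derivatives `U'` within `[0, t₁]`, `U(0) < M`, and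
`U' s ≤ 0` whenever `U s < M`, then `U < M` on `[0, t₁]` (first hitting time argument; for
`t₁ < 0` the statement is empty).
[folklore] -/
private theorem lt_of_deriv_nonpos_below {U U' : ℝ → ℝ} {t₁ M : ℝ}
    (hder : ∀ s ∈ Icc 0 t₁, HasDerivWithinAt U (U' s) (Icc 0 t₁) s) (h0 : U 0 < M)
    (hle : ∀ s ∈ Icc 0 t₁, U s < M → U' s ≤ 0) : ∀ s ∈ Icc 0 t₁, U s < M := by
  have hcont : ContinuousOn U (Icc 0 t₁) := fun s hs => (hder s hs).continuousWithinAt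
  by_contra hnot
  obtain ⟨s₀, hs₀, hs₀M⟩ : ∃ s ∈ Icc 0 t₁, M ≤ U s := by
    simpa only [not_forall, not_lt, exists_prop] using hnot
  -- the closed nonempty set of times where `U ≥ M`, and its infimum `t*`
  set S : Set ℝ := Icc 0 t₁ ∩ U ⁻¹' Ici M with hS
  have hSne : S.Nonempty := ⟨s₀, hs₀, hs₀M⟩
  have hSclosed : IsClosed S := hcont.preimage_isClosed_of_isClosed isClosed_Icc isClosed_Ici
  have hSbdd : BddBelow S := ⟨0, fun s hs => hs.1.1⟩
  set tstar : ℝ := sInf S with htstar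
  have htS : tstar ∈ S := hSclosed.csInf_mem hSne hSbdd
  have ht0 : 0 ≤ tstar := htS.1.1
  have htM : M ≤ U tstar := htS.2
  -- `U < M` strictly before `t*`
  have hbefore : ∀ s ∈ Ico 0 tstar, U s < M := by
    intro s hs
    by_contra hsM
    have hsS : s ∈ S := ⟨⟨hs.1, hs.2.le.trans htS.1.2⟩, not_lt.1 hsM⟩
    exact absurd (csInf_le hSbdd hsS) (not_le.2 hs.2)
  have htpos : 0 < tstar := by
    rcases ht0.eq_or_lt with h | h
    · exfalso; rw [← h] at htM; linarith
    · exact h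
  -- `U` is non-increasing on `[0, s]` for every `s < t*`, hence `U s ≤ U 0` there
  have hanti : ∀ s ∈ Ico 0 tstar, U s ≤ U 0 := by
    intro s hs
    rcases hs.1.eq_or_lt with h0s | h0s
    · rw [← h0s]
    have hsub : Icc 0 s ⊆ Icc 0 t₁ := Icc_subset_Icc le_rfl (hs.2.le.trans htS.1.2)
    have hderiv : ∀ r ∈ Icc 0 s, HasDerivWithinAt U (U' r) (Icc 0 s) r := fun r hr =>
      (hder r (hsub hr)).mono hsub
    have hnonpos : ∀ r ∈ interior (Icc 0 s), U' r ≤ 0 := by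
      intro r hr
      rw [interior_Icc] at hr
      exact hle r (hsub ⟨hr.1.le, hr.2.le⟩) (hbefore r ⟨hr.1.le, hr.2.trans hs.2⟩)
    have hmono := antitoneOn_of_hasDerivWithinAt_nonpos (convex_Icc 0 s)
      (fun r hr => (hderiv r hr).continuousWithinAt)
      (fun r hr => (hderiv r (interior_subset hr)).mono interior_subset) hnonpos
    exact hmono ⟨le_rfl, h0s.le⟩ ⟨h0s.le, le_rfl⟩ h0s.le
  -- continuity from the left at `t*` gives `U t* ≤ U 0 < M`, a contradiction
  have hlim : U tstar ≤ U 0 := by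
    have hcw : ContinuousWithinAt U (Ico 0 tstar) tstar :=
      (hcont tstar htS.1).mono fun s hs => ⟨hs.1, hs.2.le.trans htS.1.2⟩
    have hmem : tstar ∈ closure (Ico 0 tstar) := by
      rw [closure_Ico htpos.ne]; exact ⟨htpos.le, le_rfl⟩
    exact ContinuousWithinAt.closure_le hmem hcw continuousWithinAt_const fun s hs => hanti s hs
  linarith

end SmallL3

open SmallL3

/-! ## 5. Small `L³` data: the solution stays small and continues -/

/-- **Robinson–Sadowski 2014, Theorem 6 (ii) (small data in `L³`), continuation form on `T³`.**
Printed: "if `u₀ ∈ L³ ∩ L²` and `‖u₀‖_{L³}` is sufficiently small then the equations have a unique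
global solution `u ∈ L^∞(0, ∞; L³)`" (Kato 1984 by the energy method; `ν = 1`). Here: on the unit
torus `T^d`, `card d = 3`, there is `ε = ε(d) > 0` such that every classical solution of the
unforced Navier–Stokes equations with viscosity `ν > 0` on `[0, T) × T^d`, `T > 0`, with mean-zero
velocity slices and `∫‖u(0)‖³ ≤ ε ν³` satisfies `∫‖u(t)‖³ ≤ ∫‖u(0)‖³` for all `t ∈ [0, T)` and
continues to a classical solution with mean-zero slices on some `[0, T'] × T^d`, `T' > T`, equal
to `u` on `[0, T)` — so the smallness is inherited at every later time and the continuation can be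
iterated. Proof: the `L³` balance closes under smallness (`R ≤ −(3ν/2)∫|u||∇u|²`), trapping,
`∫₀ᵗ‖u‖_{L⁹}³ ≤ 2c∫‖u(0)‖³/(3ν)`, and Serrin's condition with `(r, s) = (3, 9)`.
[cite: RobinsonSadowski2014, Theorem 6 (ii) (p. 172)] -/
theorem Torus.classicalNS_continuation_of_small_L3 (hd : Fintype.card d = 3) :
    ∃ ε : ℝ, 0 < ε ∧ ∀ {ν T : ℝ}, 0 < ν → 0 < T →
      ∀ {u : ℝ → UnitAddTorus d → EuclideanSpace ℝ d} {p : ℝ → UnitAddTorus d → ℝ},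
        Torus.IsClassicalNSSolutionOn (Ico 0 T) ν 0 u p →
        (∀ t ∈ Ico 0 T, Torus.HasZeroMean (u t)) →
        ∫ x, ‖u 0 x‖ ^ (3 : ℝ) ≤ ε * ν ^ 3 →
        (∀ t ∈ Ico 0 T, ∫ x, ‖u t x‖ ^ (3 : ℝ) ≤ ∫ x, ‖u 0 x‖ ^ (3 : ℝ)) ∧
        ∃ T' : ℝ, T < T' ∧ ∃ (u' : ℝ → UnitAddTorus d → EuclideanSpace ℝ d)
          (p' : ℝ → UnitAddTorus d → ℝ), Torus.IsClassicalNSSolutionOn (Icc 0 T') ν 0 u' p' ∧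
            (∀ t ∈ Icc 0 T', Torus.HasZeroMean (u' t)) ∧ ∀ t ∈ Ico 0 T, u' t = u t := by
  obtain ⟨κ, hκ0, hκ⟩ := exists_deriv_le_preYoung (d := d) hd (q := 3) le_rfl
  obtain ⟨c, hc0, hc⟩ := Torus.exists_rpow_integral_norm_rpow_le_weighted (d := d) hd
    (a := 3) (by norm_num)
  -- threshold: `κ U^{2/3} ≤ (3/2)ν²(κ/(κ+1))` when `U ≤ M(ν) = (3ν²/(2(κ+1)))^{3/2}`
  set β : ℝ := (3 / (2 * (κ + 1))) with hβ
  have hβ0 : 0 < β := by rw [hβ]; positivity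
  set ε : ℝ := β ^ (3 / 2 : ℝ) / 2 with hε
  have hε0 : 0 < ε := by rw [hε]; positivity
  refine ⟨ε, hε0, fun {ν T} hν hT {u p} h hmean hsmall => ?_⟩
  set M : ℝ := (β * ν ^ 2) ^ (3 / 2 : ℝ) with hM
  have hβν : 0 < β * ν ^ 2 := by positivity
  have hM0 : 0 < M := Real.rpow_pos_of_pos hβν _
  have hεM : ε * ν ^ 3 < M := by
    have e1 : M = β ^ (3 / 2 : ℝ) * ν ^ 3 := by
      rw [hM, Real.mul_rpow hβ0.le (sq_nonneg ν), ← Real.rpow_natCast ν 2,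
        ← Real.rpow_natCast ν 3, ← Real.rpow_mul hν.le]
      norm_num
    rw [e1, hε]
    have : 0 < β ^ (3 / 2 : ℝ) * ν ^ 3 := by positivity
    linarith
  set U : ℝ → ℝ := fun s => ∫ x, ‖u s x‖ ^ (3 : ℝ) with hU
  set X : ℝ → ℝ := fun s => ∫ x, ‖u s x‖ ^ ((3 : ℝ) - 2) *
    ∑ k, ‖Torus.partialDeriv k (u s) x‖ ^ 2 with hX
  have hUnn : ∀ s, 0 ≤ U s := fun s => integral_nonneg fun x => Real.rpow_nonneg (norm_nonneg _) _
  have hXnn : ∀ s, 0 ≤ X s := fun s => integral_nonneg fun x =>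
    mul_nonneg (Real.rpow_nonneg (norm_nonneg _) _) (Finset.sum_nonneg fun k _ => sq_nonneg _)
  have hU0M : U 0 < M := lt_of_le_of_lt hsmall hεM
  -- the closed differential inequality below the threshold
  have hclosed : ∀ {a' b' : ℝ}, 0 ≤ a' → a' < b' → Icc a' b' ⊆ Ico 0 T →
      ∀ s ∈ Icc a' b', ∀ R : ℝ, HasDerivWithinAt U R (Icc a' b') s → U s < M →
        R ≤ -(3 / 2 * ν * X s) := by
    intro a' b' ha' hab' hsub s hs R hR hUM
    have h' : Torus.IsClassicalNSSolutionOn (Icc a' b') ν 0 u p :=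
      h.mono hsub (uniqueDiffOn_Icc hab')
    have h1 := hκ hν hab' h' (fun r hr => hmean r (hsub hr)) s hs R hR
    -- `κ ν⁻¹ U^{2/3} X ≤ (3/2) ν X`
    have hU23 : U s ^ (((3 : ℝ) - 1) / 3) ≤ β * ν ^ 2 := by
      have e : (((3 : ℝ) - 1) / 3) = (2 / 3 : ℝ) := by norm_num
      rw [e]
      have h2 : U s ^ (2 / 3 : ℝ) ≤ M ^ (2 / 3 : ℝ) :=
        Real.rpow_le_rpow (hUnn s) hUM.le (by norm_num)
      have e2 : M ^ (2 / 3 : ℝ) = β * ν ^ 2 := by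
        rw [hM, ← Real.rpow_mul hβν.le]; norm_num
      rw [e2] at h2
      exact h2
    have hX1 : X s ^ ((3 : ℝ) / 3) = X s := by norm_num
    rw [hX1] at h1
    have hkey : κ * ν⁻¹ * (U s ^ (((3 : ℝ) - 1) / 3) * X s) ≤ 3 / 2 * ν * X s := by
      have h2 : κ * ν⁻¹ * (U s ^ (((3 : ℝ) - 1) / 3) * X s) ≤ κ * ν⁻¹ * (β * ν ^ 2 * X s) :=
        mul_le_mul_of_nonneg_left (mul_le_mul_of_nonneg_right hU23 (hXnn s))
          (mul_nonneg hκ0 (inv_nonneg.2 hν.le))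
      have h3 : κ * ν⁻¹ * (β * ν ^ 2 * X s) = (κ / (κ + 1)) * (3 / 2 * ν * X s) := by
        rw [hβ]; field_simp
      have h4 : (κ / (κ + 1)) * (3 / 2 * ν * X s) ≤ 1 * (3 / 2 * ν * X s) :=
        mul_le_mul_of_nonneg_right ((div_le_one (by linarith)).2 (by linarith))
          (by positivity)
      linarith
    have : -(3 * ν * X s) + κ * ν⁻¹ * (U s ^ (((3 : ℝ) - 1) / 3) * X s) ≤ -(3 / 2 * ν * X s) := by
      linarith
    exact h1.trans this
  -- ### on every closed window `[0, t₁] ⊆ [0, T)`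
  have hwindow : ∀ t₁ ∈ Ico 0 T, 0 < t₁ →
      (∀ s ∈ Icc 0 t₁, U s ≤ U 0) ∧ 3 / 2 * ν * ∫ s in (0 : ℝ)..t₁, X s ≤ U 0 := by
    intro t₁ ht₁ h0t₁
    have hsub : Icc 0 t₁ ⊆ Ico 0 T := fun s hs => ⟨hs.1, hs.2.trans_lt ht₁.2⟩
    have h' : Torus.IsClassicalNSSolutionOn (Icc 0 t₁) ν 0 u p := h.mono hsub (uniqueDiffOn_Icc h0t₁)
    -- derivatives of `U` within `[0, t₁]`
    have hder : ∀ s ∈ Icc 0 t₁, ∃ R, HasDerivWithinAt U R (Icc 0 t₁) s := fun s hs =>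
      hasDerivWithinAt_integral_norm_rpow h'.smooth_velocity h0t₁ (by norm_num) hs
    choose! Ud hUd using hder
    -- trapping: `U < M` on `[0, t₁]`
    have hlt : ∀ s ∈ Icc 0 t₁, U s < M :=
      lt_of_deriv_nonpos_below hUd hU0M fun s hs hsM => by
        have := hclosed le_rfl h0t₁ hsub s hs (Ud s) (hUd s hs) hsM
        have hX0 := hXnn s
        have : Ud s ≤ 0 := this.trans (by nlinarith [hν.le])
        exact this
    have hUd_le : ∀ s ∈ Icc 0 t₁, Ud s ≤ -(3 / 2 * ν * X s) := fun s hs =>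
      hclosed le_rfl h0t₁ hsub s hs (Ud s) (hUd s hs) (hlt s hs)
    -- the primitive of `X` and the non-increasing function `Φ = U + (3ν/2) ∫₀ X`
    have hXc : ContinuousOn X (Icc 0 t₁) := continuousOn_weightedDissipation h0t₁ h'
    set Pr : ℝ → ℝ := fun s => ∫ r in (0 : ℝ)..s, X r with hPr
    have hPrd : ∀ s ∈ Icc 0 t₁, HasDerivWithinAt Pr (X s) (Icc 0 t₁) s := by
      intro s hs
      haveI : Fact (s ∈ Icc 0 t₁) := ⟨hs⟩
      have hint : IntervalIntegrable X volume 0 s :=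
        (hXc.mono (Icc_subset_Icc_right hs.2)).intervalIntegrable_of_Icc hs.1
      exact intervalIntegral.integral_hasDerivWithinAt_right hint
        (hXc.stronglyMeasurableAtFilter_nhdsWithin measurableSet_Icc s) (hXc s hs)
    set Φ : ℝ → ℝ := fun s => U s + 3 / 2 * ν * Pr s with hΦ
    have hΦd : ∀ s ∈ Icc 0 t₁, HasDerivWithinAt Φ (Ud s + 3 / 2 * ν * X s) (Icc 0 t₁) s :=
      fun s hs => (hUd s hs).add ((hPrd s hs).const_mul _)
    have hΦanti : AntitoneOn Φ (Icc 0 t₁) :=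
      antitoneOn_of_hasDerivWithinAt_nonpos (convex_Icc 0 t₁)
        (fun s hs => (hΦd s hs).continuousWithinAt)
        (fun s hs => (hΦd s (interior_subset hs)).mono interior_subset)
        (fun s hs => by linarith [hUd_le s (interior_subset hs)])
    have hΦ0 : Φ 0 = U 0 := by simp [hΦ, hPr]
    have hPr0 : ∀ s ∈ Icc 0 t₁, 0 ≤ Pr s := fun s hs =>
      intervalIntegral.integral_nonneg hs.1 fun r hr => hXnn r
    refine ⟨fun s hs => ?_, ?_⟩
    · have h1 := hΦanti ⟨le_rfl, h0t₁.le⟩ hs hs.1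
      rw [hΦ0] at h1
      have h2 := hPr0 s hs
      have : U s + 3 / 2 * ν * Pr s ≤ U 0 := h1
      nlinarith [hν.le]
    · have h1 := hΦanti ⟨le_rfl, h0t₁.le⟩ ⟨h0t₁.le, le_rfl⟩ h0t₁.le
      rw [hΦ0] at h1
      have : U t₁ + 3 / 2 * ν * Pr t₁ ≤ U 0 := h1
      linarith [hUnn t₁]
  -- ### conclusion 1: `U ≤ U(0)` on `[0, T)`
  have hmonotone : ∀ t ∈ Ico 0 T, U t ≤ U 0 := by
    intro t ht
    rcases ht.1.eq_or_lt with h0 | h0t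
    · rw [← h0]
    · exact (hwindow t ht h0t).1 t ⟨h0t.le, le_rfl⟩
  refine ⟨hmonotone, ?_⟩
  -- ### conclusion 2: Serrin's condition with `(r, s) = (3, 9)`
  have hs9 : (3 : ℝ) < 3 * 3 := by norm_num
  set N : ℝ → ℝ := fun t => (∫ x, ‖u t x‖ ^ (3 * (3 : ℝ))) ^ (1 / (3 * (3 : ℝ))) with hN
  have hB0 : ∀ t, 0 ≤ ∫ x, ‖u t x‖ ^ (3 * (3 : ℝ)) := fun t =>
    integral_nonneg fun x => Real.rpow_nonneg (norm_nonneg _) _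
  have hNc : ContinuousOn N (Ico 0 T) :=
    (continuousOn_integral_norm_rpow h (by norm_num : (0 : ℝ) ≤ 3 * 3)).rpow_const
      fun t _ => Or.inr (by norm_num)
  have hN0 : ∀ t ∈ Ico 0 T, 0 ≤ N t := fun t _ => Real.rpow_nonneg (hB0 t) _
  -- `N^{2s/(s−3)} = (∫‖u‖⁹)^{1/3} ≤ c X`
  have hNpow : ∀ t ∈ Ico 0 T, N t ^ (2 * (3 * (3 : ℝ)) / (3 * 3 - 3)) ≤ c * X t := by
    intro t ht
    have hut : Torus.IsSmooth (u t) := h.smooth_velocity.isSmooth_slice ht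
    have hL := hc (u t) hut (hmean t ht)
    have e : N t ^ (2 * (3 * (3 : ℝ)) / (3 * 3 - 3)) =
        (∫ x, ‖u t x‖ ^ (3 * (3 : ℝ))) ^ (1 / 3 : ℝ) := by
      rw [hN]
      simp only
      rw [← Real.rpow_mul (hB0 t)]
      norm_num
    rw [e]
    exact hL
  set I : ℝ := c * (2 * U 0 / (3 * ν)) with hI
  refine Torus.classicalNS_continuation_of_Ls_rpow_integral_le hd hν hT hs9 h hmean hNc hN0
    (fun t ht => le_rfl) (I := I) fun t ht => ?_
  rcases ht.1.eq_or_lt with h0 | h0t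
  · rw [← h0, intervalIntegral.integral_same, hI]
    have := hUnn 0
    positivity
  · have hsub : Icc 0 t ⊆ Ico 0 T := fun s hs => ⟨hs.1, hs.2.trans_lt ht.2⟩
    have h' : Torus.IsClassicalNSSolutionOn (Icc 0 t) ν 0 u p := h.mono hsub (uniqueDiffOn_Icc h0t)
    have hXc : ContinuousOn X (Icc 0 t) := continuousOn_weightedDissipation h0t h'
    have hNc' : ContinuousOn (fun s => N s ^ (2 * (3 * (3 : ℝ)) / (3 * 3 - 3))) (Icc 0 t) :=
      (hNc.mono hsub).rpow_const fun s _ => Or.inr (by norm_num)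
    have hmono : ∫ s in (0 : ℝ)..t, N s ^ (2 * (3 * (3 : ℝ)) / (3 * 3 - 3)) ≤
        ∫ s in (0 : ℝ)..t, c * X s :=
      intervalIntegral.integral_mono_on h0t.le (hNc'.intervalIntegrable_of_Icc h0t.le)
        ((continuousOn_const.mul hXc).intervalIntegrable_of_Icc h0t.le)
        fun s hs => hNpow s (hsub hs)
    have hXint := (hwindow t ht h0t).2
    calc ∫ s in (0 : ℝ)..t, N s ^ (2 * (3 * (3 : ℝ)) / (3 * 3 - 3))
        ≤ ∫ s in (0 : ℝ)..t, c * X s := hmono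
      _ = c * ∫ s in (0 : ℝ)..t, X s := by rw [intervalIntegral.integral_const_mul]
      _ ≤ c * (2 * U 0 / (3 * ν)) := by
          refine mul_le_mul_of_nonneg_left ?_ hc0
          rw [le_div_iff₀ (by positivity)]
          linarith
      _ = I := rfl

end Literature.Analysis.FluidPDE
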